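import Literature.NumberTheory.Rogawski1990.LocalTransfer
import Literature.NumberTheory.Automorphic.LocalUnitaryGroupCongr
import HarnessLib

/-!
# (14.2.1) along a class-preserving identification `ψ : G′ → G` — the algebraic half of the unramified local transfer
# («if `v ∉ S`, (14.2.1) is obviously satisfied»)
(Rogawski, *Automorphic representations of unitary groups in three variables* (1990), §14.2 p. 232)

Topic `NumberTheory/Rogawski1990`; namespace `Literature.NumberTheory.Rogawski1990` (sequel of ★ `LocalTransfer`, LETTER #3).
THEOREMS ONLY: no definition, no named fact, no `sorry`, no instance.

For two unitary groups `G′ = U(σ, H′)(R)`, `G = U(σ, H)(R)` in the same `GL_n(R)` and a map `ψ : G′ → G` that is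
**CLASS-PRESERVING** — `γ′ ↔ ψ γ′` for every `γ′` (★ `Corresponds σ H′ H`: conjugate in the common `GL_n(R)`), as is every
identification of CONGRUENCE type `x ↦ g x g⁻¹` (★ `corresponds_unitaryGroupCongr`), in particular the tree's local
identifications of the inner form with the quasi-split group (★ `localFormCongr`, ★ `cmDatumLocalCongr`) — and SURJECTIVE:

* §1 `isStablyConj_iff_of_corresponds` (ψ preserves and reflects stable conjugacy), `isRegularElt_iff_of_corresponds`,
  `exists_corresponds_of_surjective` (EVERY `γ ∈ G` occurs in `G′`: the vanishing branch of (14.2.1) is VACUOUS), and the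
  reformulation **`isInnerTransfer_iff_forall_eq`**: `IsInnerTransfer σ H H′ m′ m f′ f ↔ ∀ γ′ regular, Φ^st_G(ψ γ′, f) = Φ^st_{G′}(γ′, f′)`
  — (14.2.1) is the `ψ`-EQUIVARIANCE of the stable orbital integrals; `isInnerTransfer_iff_unitaryGroupCongr` (congruence case).
* §2 the CM-local reading on `(UnitaryGroup.cmDatum L 3 ·).Local v` (★ `IsLocalInnerTransfer`): `isLocalInnerTransfer_iff_forall_eq`
  for any class-preserving surjective `ψ_v : U(H′)(L⁺_v) → U(Φ₃)(L⁺_v)`, and `corresponds_localFormCongr` — the local identifications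
  `g ↦ T g T⁻¹` from a local similitude `ᵗ(T̄) H′_v T = a • (Φ₃)_v` (★ `localFormCongr`, the output of ★ B4∕B3 at non-split ∕ all places) ARE
  class-preserving.

What is NOT here (brick (L6b), `LocalTransferTransport`): the ANALYTIC half — for `f := f′ ∘ ψ⁻¹` and the TRANSPORTED measure family
`m := ψ_* m′` the right-hand side of `isInnerTransfer_iff_forall_eq` holds (orbital integrals transport along `ψ`), so `f′_v ↦ f′_v ∘ ψ_v⁻¹`
IS a transfer (14.2.1) for compatible measures; and (L6c) the H-side unit ↦ unit = the fundamental lemma [Rogawski1990, Prop. 4.9.1 (b)],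
a named fact.  HC_CM is proved only modulo the printed citations until rung 0 closes; this file is unconditional.

## References
* [Rogawski1990] J. Rogawski, Ann. of Math. Stud. 123 (1990), §14.1–14.2 p. 232 ((14.2.1); «if `v ∉ S`, (14.2.1) is obviously satisfied»).
-/

set_option autoImplicit false

noncomputable section

open MeasureTheory NumberField IsDedekindDomain
open scoped Matrix MatrixGroups

namespace Literature.NumberTheory.Rogawski1990

open Literature.NumberTheory.Automorphic
open Literature.AlgebraicGeometry.ShimuraVarieties (unitaryGroup)

/-! ## §0 Abstract form: (14.2.1) along a class-preserving surjection -/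

section Abstract

variable {A B : Type*} [Group A] [Group B]
  [∀ a : A, MeasurableSpace (A ⧸ Subgroup.centralizer ({a} : Set A))]
  [∀ b : B, MeasurableSpace (B ⧸ Subgroup.centralizer ({b} : Set B))]

/-- **Abstract (14.2.1) along `ψ : B → A`**: if `ψ` is class-preserving (`corr b (ψ b)`), surjective, `corr` transports
regularity (`corr b a → (regB b ↔ regA a)`) and `corr b a` forces `a` and `ψ b` to have the same `stA`-class, then
`IsInnerTransferRel corr stB stA regA m′ m f′ f ↔ ∀ b, regB b → Φ^st_A(ψ b, f) = Φ^st_B(b, f′)`.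
[cite: Rogawski1990, §14.2 (14.2.1) p. 232] -/
theorem isInnerTransferRel_iff_forall_eq (corr : B → A → Prop) (stB : B → B → Prop) (stA : A → A → Prop)
    (regA : A → Prop) (regB : B → Prop) (ψ : B → A) (hψ : ∀ b, corr b (ψ b)) (hsurj : Function.Surjective ψ)
    (hreg : ∀ b a, corr b a → (regB b ↔ regA a)) (hst : ∀ b a, corr b a → ∀ c, stA a c ↔ stA (ψ b) c)
    (m' : OrbitalMeasureFamily B) (m : OrbitalMeasureFamily A) (f' : B → ℂ) (f : A → ℂ) :
    IsInnerTransferRel corr stB stA regA m' m f' f ↔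
      ∀ b : B, regB b → stableOrbitalIntegralRel stA m f (ψ b) = stableOrbitalIntegralRel stB m' f' b := by
  constructor
  · intro h b hb
    exact (h (ψ b) ((hreg b (ψ b) (hψ b)).1 hb)).1 b (hψ b)
  · intro h a ha
    refine ⟨fun b hc => ?_, fun hno => ?_⟩
    · rw [stableOrbitalIntegralRel_congr (hst b a hc) m f]
      exact h b ((hreg b a hc).2 ha)
    · obtain ⟨b, rfl⟩ := hsurj a
      exact absurd (hψ b) (hno b)

end Abstract

/-! ## §1 Class-preserving identifications and (14.2.1) -/

section Unitary

variable {R : Type*} [CommRing R] {n : Type*} [Fintype n] [DecidableEq n] {σ : R →+* R} {H H' : Matrix n n R}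

/-- A class-preserving `ψ` (`γ′ ↔ ψ γ′`) PRESERVES AND REFLECTS stable conjugacy (both are conjugacy in the common `GL_n(R)`).
[cite: Rogawski1990, §14.1 p. 232] -/
theorem isStablyConj_iff_of_corresponds (ψ : unitaryGroup σ H' → unitaryGroup σ H)
    (hψ : ∀ γ', Corresponds σ H' H γ' (ψ γ')) (γ' δ' : unitaryGroup σ H') :
    IsStablyConj σ H' γ' δ' ↔ IsStablyConj σ H (ψ γ') (ψ δ') :=
  ⟨fun h => ((hψ γ').symm.trans h).trans (hψ δ'), fun h => ((hψ γ').trans h).trans (hψ δ').symm⟩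

/-- Corresponding elements are regular together. [cite: Rogawski1990, §14.2 p. 232] -/
theorem isRegularElt_iff_of_corresponds {γ' : unitaryGroup σ H'} {γ : unitaryGroup σ H} (h : Corresponds σ H' H γ' γ) :
    IsRegularElt (γ' : GL n R) ↔ IsRegularElt (γ : GL n R) :=
  ⟨isRegularElt_of_isConj h, isRegularElt_of_isConj h.symm⟩

/-- For a SURJECTIVE class-preserving `ψ` EVERY `γ ∈ G` occurs in `G′` (`ψ⁻¹ γ ↔ γ`): the vanishing branch of (14.2.1) is
vacuous. [cite: Rogawski1990, §14.2 p. 232] -/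
theorem exists_corresponds_of_surjective (ψ : unitaryGroup σ H' → unitaryGroup σ H)
    (hψ : ∀ γ', Corresponds σ H' H γ' (ψ γ')) (hsurj : Function.Surjective ψ) (γ : unitaryGroup σ H) :
    ∃ γ' : unitaryGroup σ H', Corresponds σ H' H γ' γ := by
  obtain ⟨γ', rfl⟩ := hsurj γ
  exact ⟨γ', hψ γ'⟩

variable [∀ γ : unitaryGroup σ H, MeasurableSpace (unitaryGroup σ H ⧸ Subgroup.centralizer ({γ} : Set (unitaryGroup σ H)))]
variable [∀ γ : unitaryGroup σ H', MeasurableSpace (unitaryGroup σ H' ⧸ Subgroup.centralizer ({γ} : Set (unitaryGroup σ H')))]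

/-- **(14.2.1) along a class-preserving surjective `ψ : G′ → G` is `ψ`-EQUIVARIANCE of `Φ^st`**:
`IsInnerTransfer σ H H′ m′ m f′ f ↔ ∀ γ′ regular, Φ^st_G(ψ γ′, f; m) = Φ^st_{G′}(γ′, f′; m′)` (the matching branch at `γ = ψ γ′`;
conversely a regular `γ` with `γ′ ↔ γ` is stably conjugate to `ψ γ′`, and `Φ^st` is a stable-class function ★
`stableOrbitalIntegral_eq_of_isStablyConj`; the vanishing branch never fires). [cite: Rogawski1990, §14.2 (14.2.1) p. 232] -/
theorem isInnerTransfer_iff_forall_eq (ψ : unitaryGroup σ H' → unitaryGroup σ H) (hψ : ∀ γ', Corresponds σ H' H γ' (ψ γ'))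
    (hsurj : Function.Surjective ψ) (m' : OrbitalMeasureFamily (unitaryGroup σ H')) (m : OrbitalMeasureFamily (unitaryGroup σ H))
    (f' : unitaryGroup σ H' → ℂ) (f : unitaryGroup σ H → ℂ) :
    IsInnerTransfer σ H H' m' m f' f ↔
      ∀ γ' : unitaryGroup σ H', IsRegularElt (γ' : GL n R) →
        stableOrbitalIntegral σ H m f (ψ γ') = stableOrbitalIntegral σ H' m' f' γ' :=
  isInnerTransferRel_iff_forall_eq (Corresponds σ H' H) (IsStablyConj σ H') (IsStablyConj σ H)
    (fun γ : unitaryGroup σ H => IsRegularElt (γ : GL n R)) (fun γ' : unitaryGroup σ H' => IsRegularElt (γ' : GL n R)) ψ hψ hsurj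
    (fun _ _ hc => isRegularElt_iff_of_corresponds hc)
    (fun γ' _ hc _ => ⟨fun h => ((hψ γ').symm.trans hc).trans h, fun h => (hc.symm.trans (hψ γ')).trans h⟩) m' m f' f

/-- Sufficient form: `ψ`-equivariance of `Φ^st` on regular elements gives (14.2.1). [cite: Rogawski1990, §14.2 (14.2.1) p. 232] -/
theorem isInnerTransfer_of_forall_eq (ψ : unitaryGroup σ H' → unitaryGroup σ H) (hψ : ∀ γ', Corresponds σ H' H γ' (ψ γ'))
    (hsurj : Function.Surjective ψ) {m' : OrbitalMeasureFamily (unitaryGroup σ H')} {m : OrbitalMeasureFamily (unitaryGroup σ H)}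
    {f' : unitaryGroup σ H' → ℂ} {f : unitaryGroup σ H → ℂ}
    (h : ∀ γ' : unitaryGroup σ H', IsRegularElt (γ' : GL n R) →
      stableOrbitalIntegral σ H m f (ψ γ') = stableOrbitalIntegral σ H' m' f' γ') :
    IsInnerTransfer σ H H' m' m f' f :=
  (isInnerTransfer_iff_forall_eq ψ hψ hsurj m' m f' f).2 h

/-- **Congruent forms** (`ᵗ(σ g) H g = H′`, ★ `unitaryGroupCongr σ g H H′ : U(H′) ≃* U(H)`, `x ↦ g x g⁻¹`): (14.2.1) ⟺
`∀ γ′ regular, Φ^st_G(g γ′ g⁻¹, f) = Φ^st_{G′}(γ′, f′)`. [cite: Rogawski1990, §14.2 (14.2.1) p. 232] -/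
theorem isInnerTransfer_iff_unitaryGroupCongr (g : GL n R) (hg : ((g : Matrix n n R).map σ)ᵀ * H * (g : Matrix n n R) = H')
    (m' : OrbitalMeasureFamily (unitaryGroup σ H')) (m : OrbitalMeasureFamily (unitaryGroup σ H))
    (f' : unitaryGroup σ H' → ℂ) (f : unitaryGroup σ H → ℂ) :
    IsInnerTransfer σ H H' m' m f' f ↔
      ∀ γ' : unitaryGroup σ H', IsRegularElt (γ' : GL n R) →
        stableOrbitalIntegral σ H m f (unitaryGroupCongr σ g H H' hg γ') = stableOrbitalIntegral σ H' m' f' γ' :=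
  isInnerTransfer_iff_forall_eq _ (corresponds_unitaryGroupCongr g hg) (unitaryGroupCongr σ g H H' hg).surjective m' m f' f

end Unitary

/-! ## §2 The CM-local reading: `IsLocalInnerTransfer` along a class-preserving `ψ_v` -/

section CM

variable (L : Type) [Field L] [NumberField L] [IsCMField L] (H' : Matrix (Fin 3) (Fin 3) L)
  (v : HeightOneSpectrum (𝓞 ↥(maximalRealSubfield L)))

/-- **The local identifications of congruence type are class-preserving**: for a local similitude
`ᵗ((c ⊗ 1) T) · H_v · T = a • H′_v` (★ `localFormCongr c v T ha h : U(H′)(L⁺_v) ≃ₜ* U(H)(L⁺_v)`, `g ↦ T g T⁻¹` — the shape delivered by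
★ `exists_isUnit_formCongr_map_eq_smul_antidiag_of_smul_eq` at non-split places), `γ′ ↔ ψ_v γ′` for every `γ′`.
[cite: Rogawski1990, §14.1 p. 232] -/
theorem corresponds_localFormCongr {N : ℕ} {H H'' : Matrix (Fin N) (Fin N) L} (T : GL (Fin N) (UnitaryGroup.LocalRing L v))
    {a : UnitaryGroup.LocalRing L v} (ha : IsUnit a)
    (h : formCongr (UnitaryGroup.conjLocal L (IsCMField.complexConj L) v) T (H.map (algebraMap L (UnitaryGroup.LocalRing L v))) =
      a • H''.map (algebraMap L (UnitaryGroup.LocalRing L v)))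
    (γ' : (UnitaryGroup.cmDatum L N H'').Local v) :
    Corresponds (UnitaryGroup.conjLocal L (IsCMField.complexConj L) v)
      ((UnitaryGroup.adelicForm L N H'').map (UnitaryGroup.adeleToLocal L v))
      ((UnitaryGroup.adelicForm L N H).map (UnitaryGroup.adeleToLocal L v))
      γ' (UnitaryGroup.localFormCongr (IsCMField.complexConj L) v T ha h γ') :=
  isConj_iff.mpr ⟨T, by rw [UnitaryGroup.coe_localFormCongr_apply]⟩

/-- **(14.2.1) at `v` along a class-preserving surjective `ψ_v : U(H′)(L⁺_v) → U(Φ₃)(L⁺_v)` is `ψ_v`-equivariance of the local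
stable orbital integrals**: `IsLocalInnerTransfer L H′ v m′ m f′ f ↔ ∀ γ′ regular, Φ^st(ψ_v γ′, f; m) = Φ^st(γ′, f′; m′)`.
[cite: Rogawski1990, §14.2 (14.2.1) p. 232] -/
theorem isLocalInnerTransfer_iff_forall_eq
    {_hγ : ∀ γ : (UnitaryGroup.cmDatum L 3 H').Local v,
      MeasurableSpace ((UnitaryGroup.cmDatum L 3 H').Local v ⧸ Subgroup.centralizer ({γ} : Set ((UnitaryGroup.cmDatum L 3 H').Local v)))}
    {_hγ' : ∀ γ : (UnitaryGroup.cmDatum L 3 (Matrix.of fun i j : Fin 3 => if i.val + j.val + 1 = 3 then (1 : L) else 0)).Local v,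
      MeasurableSpace ((UnitaryGroup.cmDatum L 3 (Matrix.of fun i j : Fin 3 => if i.val + j.val + 1 = 3 then (1 : L) else 0)).Local v ⧸
        Subgroup.centralizer ({γ} : Set ((UnitaryGroup.cmDatum L 3 (Matrix.of fun i j : Fin 3 => if i.val + j.val + 1 = 3 then (1 : L) else 0)).Local v)))}
    (ψ : (UnitaryGroup.cmDatum L 3 H').Local v →
      (UnitaryGroup.cmDatum L 3 (Matrix.of fun i j : Fin 3 => if i.val + j.val + 1 = 3 then (1 : L) else 0)).Local v)
    (hψ : ∀ γ', Corresponds (UnitaryGroup.conjLocal L (IsCMField.complexConj L) v)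
      ((UnitaryGroup.adelicForm L 3 H').map (UnitaryGroup.adeleToLocal L v))
      ((UnitaryGroup.adelicForm L 3 (Matrix.of fun i j : Fin 3 => if i.val + j.val + 1 = 3 then (1 : L) else 0)).map
        (UnitaryGroup.adeleToLocal L v)) γ' (ψ γ'))
    (hsurj : Function.Surjective ψ)
    (m' : OrbitalMeasureFamily ((UnitaryGroup.cmDatum L 3 H').Local v))
    (m : OrbitalMeasureFamily
      ((UnitaryGroup.cmDatum L 3 (Matrix.of fun i j : Fin 3 => if i.val + j.val + 1 = 3 then (1 : L) else 0)).Local v))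
    (f' : (UnitaryGroup.cmDatum L 3 H').Local v → ℂ)
    (f : (UnitaryGroup.cmDatum L 3 (Matrix.of fun i j : Fin 3 => if i.val + j.val + 1 = 3 then (1 : L) else 0)).Local v → ℂ) :
    IsLocalInnerTransfer L H' v m' m f' f ↔
      ∀ γ' : (UnitaryGroup.cmDatum L 3 H').Local v, IsRegularElt (γ'.val : GL (Fin 3) (UnitaryGroup.LocalRing L v)) →
        localStableOrbitalIntegral L 3 (Matrix.of fun i j : Fin 3 => if i.val + j.val + 1 = 3 then (1 : L) else 0) v m f (ψ γ') =
          localStableOrbitalIntegral L 3 H' v m' f' γ' :=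
  isInnerTransferRel_iff_forall_eq
    (A := (UnitaryGroup.cmDatum L 3 (Matrix.of fun i j : Fin 3 => if i.val + j.val + 1 = 3 then (1 : L) else 0)).Local v)
    (B := (UnitaryGroup.cmDatum L 3 H').Local v)
    (Corresponds (UnitaryGroup.conjLocal L (IsCMField.complexConj L) v)
      ((UnitaryGroup.adelicForm L 3 H').map (UnitaryGroup.adeleToLocal L v))
      ((UnitaryGroup.adelicForm L 3 (Matrix.of fun i j : Fin 3 => if i.val + j.val + 1 = 3 then (1 : L) else 0)).map
        (UnitaryGroup.adeleToLocal L v)))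
    (IsStablyConj (UnitaryGroup.conjLocal L (IsCMField.complexConj L) v)
      ((UnitaryGroup.adelicForm L 3 H').map (UnitaryGroup.adeleToLocal L v)))
    (IsStablyConj (UnitaryGroup.conjLocal L (IsCMField.complexConj L) v)
      ((UnitaryGroup.adelicForm L 3 (Matrix.of fun i j : Fin 3 => if i.val + j.val + 1 = 3 then (1 : L) else 0)).map
        (UnitaryGroup.adeleToLocal L v)))
    (fun γ => IsRegularElt (γ.val : GL (Fin 3) (UnitaryGroup.LocalRing L v)))
    (fun γ' => IsRegularElt (γ'.val : GL (Fin 3) (UnitaryGroup.LocalRing L v))) ψ hψ hsurj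
    (fun _ _ hc => ⟨isRegularElt_of_isConj hc, isRegularElt_of_isConj hc.symm⟩)
    (fun γ' _ hc _ => ⟨fun h => ((hψ γ').symm.trans hc).trans h, fun h => (hc.symm.trans (hψ γ')).trans h⟩) m' m f' f

end CM

end Literature.NumberTheory.Rogawski1990

end
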